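import Mathlib
import HarnessLib
import Summits.HubbardSuperconductivity.HubbardSuperconductivity.Theorems.WeakCouplingBCSDefsKlU0Window
import Summits.HubbardSuperconductivity.HubbardSuperconductivity.Theorems.WeakCouplingBCSDefsKlU0WindowU1Record
import Summits.HubbardSuperconductivity.HubbardSuperconductivity.Theorems.WeakCouplingBCSDefsKlU0WindowU32Record
import Summits.HubbardSuperconductivity.HubbardSuperconductivity.Theorems.WeakCouplingBCSDefsKlU0WindowV4Record
import Summits.HubbardSuperconductivity.HubbardSuperconductivity.Theorems.WeakCouplingBCSDefsKlU0WindowWVRecord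
import Summits.HubbardSuperconductivity.HubbardSuperconductivity.Theorems.WeakCouplingBCSDefsKlU0WindowYXRecord
import Summits.HubbardSuperconductivity.HubbardSuperconductivity.Theorems.WeakCouplingBCSDefsKlU0WindowZRecord
import Summits.HubbardSuperconductivity.HubbardSuperconductivity.Theorems.WeakCouplingBCSWcbcsKohnLuttingerB1gFormAWindowD005D030
import Summits.HubbardSuperconductivity.HubbardSuperconductivity.Theorems.WeakCouplingBCSWcbcsKohnLuttingerB1gFormAWindowD005D035

/-!
# Route `WeakCouplingBCS` — channel-margin lane of the Kohn–Luttinger certificate (`WcbcsKohnLuttingerB1g`,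
# stmt-HubbardSuperconductivity-0158): explicit `U₀` ON THE WHOLE DOPING WINDOW OF RECORD, V4 thresholds — the JOIN `μ ∈ [-0.8925, -0.1775] ⊃ μ([0.10, 0.35])`

The concatenation, `μ` ascending, of the five δ ∈ [0.20, 0.35] row-record files of the lane — `klU0WindowU1Rows` (`[-0.8925, -0.8625]`), `klU0WindowU32Rows`
(`[-0.8625, -0.8025]`), `klU0WindowWVRows` (`[-0.8025, -0.7275]`), `klU0WindowYXRows` (`[-0.7275, -0.5725]`), `klU0WindowZRows` (`[-0.5725, -0.42749]`) (margin-1 g9,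
U0-TABLE v4 §B) — with the RE-TABULATED window `klU0WindowV4Rows` (`[-0.42749, -0.1775]`, narrow-cell tables, margin-1 g9/g11, U0-TABLE v4 §C) in place of the v3
`klU0WindowRows`: 222 rows = the boxes of the eleven second-order window records `klCertB1gWin{U1,U2,U3,V,W,X,Y,Z,A,B,C}`; uniform threshold
`klU0WindowD010D035V4U` = the smallest piece threshold = 1693/8388608 ≈ 2.018e-04 (attained in `klU0WindowV4Rows`; the v3 join `klU0WindowD010D035U` = 1145/2²⁴ ≈ 6.8·10⁻⁵
stays in the tree); the kernel decision `klU0WinCheck` (contiguity, cover of `[-357/400, -71/400]`, every row `ok` with `U0 ≥ u`); the soundness corollary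
(`klU0Win_sound`) and its doping forms on `δ ∈ [0.10, 0.35]` (`muOfDoping_mem_window_d010_d035`) and `δ ∈ [0.10, 0.30]` (`muOfDoping_mem_window_d010_d030`).
The selection THEOREMS on this join are `Theorems/WeakCouplingBCSKlSelectionWindowD010D035V4.lean`.
`C4 = 10` ASSUMED in every row; existence-grade numbers; nothing in this file asserts superconductivity.  Cell file: U0-TABLE.md v4 (gate-hubbard-kl, margin-1 g9/g11).
-/

noncomputable section

-- the tree's namespace `Summit.<Summit>.<Problem>.Theorems` repeats the summit name by design (D-0017)
set_option linter.dupNamespace false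

namespace Summit.HubbardSuperconductivity.HubbardSuperconductivity.Theorems

/-- The joined window rows, `μ` ascending: `klU0WindowU1Rows` (24 rows, u = 4121/8388608); `klU0WindowU32Rows` (48 rows, u = 2953/4194304); `klU0WindowWVRows` (30 rows, u = 2045/4194304); `klU0WindowYXRows` (47 rows, u = 5801/16777216); `klU0WindowZRows` (29 rows, u = 5657/16777216); `klU0WindowV4Rows` (44 rows, u = 1693/8388608). [folklore] -/
def klU0WindowD010D035V4Rows : List KLU0WinRow :=
  klU0WindowU1Rows ++ klU0WindowU32Rows ++ klU0WindowWVRows ++ klU0WindowYXRows ++ klU0WindowZRows ++ klU0WindowV4Rows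

/-- The uniform threshold of the joined window = the smallest of the pieces' thresholds (attained in `klU0WindowV4Rows`): `1693/8388608 ≈ 2.018e-04`. [folklore] -/
def klU0WindowD010D035V4U : ℚ := ((1693 : ℚ) / 8388608)

/-- Kernel decision: the 222 boxes of `klU0WindowD010D035V4Rows` are contiguous, cover `[-357/400, -71/400]`, every row passes `KLU0Row.ok` and has `U0 ≥ klU0WindowD010D035V4U`. [folklore] -/
theorem klU0WindowD010D035V4Rows_check : klU0WinCheck ((-357 : ℚ) / 400) ((-71 : ℚ) / 400) klU0WindowD010D035V4U klU0WindowD010D035V4Rows = true := by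
  decide +kernel

/-- **Explicit `U₀` on the joined window `μ ∈ [-0.8925, -0.1775]` (modulo the rows' named hypotheses)**: for every such `μ` a row of
`klU0WindowD010D035V4Rows` whose box contains `μ` such that for any real `lamB, lamX` obeying that row's certified expansion bounds against a competitor channel (intended: the
`B1g` and `χ ∈ {A1g, A2g, B2g, E}` bottoms of the pp-irreducible Cooper vertex `Γ_U/U²` through third order, chains resummed, at the level `μ`),
`lamB U < lamX U` for all `0 < U ≤ klU0WindowD010D035V4U ≈ 2.018e-04` — ONE threshold for the whole window. [cite: ScalapinoLohHirsch1986, (3)-(4)] -/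
theorem klU0WindowD010D035V4_sound :
    ∀ μ : ℝ, ((((-357 : ℚ) / 400) : ℚ) : ℝ) ≤ μ → μ ≤ ((((-71 : ℚ) / 400) : ℚ) : ℝ) →
      ∃ r ∈ klU0WindowD010D035V4Rows, ((r.mulo : ℚ) : ℝ) ≤ μ ∧ μ ≤ ((r.muhi : ℚ) : ℝ) ∧
        ∀ c ∈ r.row.chans, ∀ lamB lamX : ℝ → ℝ,
          (∀ U : ℝ, 0 < U → U ≤ r.row.U1 → lamB U ≤ r.row.rhohi + U * (r.row.c3B + r.row.tB) + U ^ 2 * (r.row.c4B + r.row.C4)) →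
          (∀ U : ℝ, 0 < U → U ≤ r.row.U1 → (c.low : ℝ) - U * (c.s3 + c.t) - U ^ 2 * (c.s4 + r.row.C4) ≤ lamX U) →
          ∀ U : ℝ, 0 < U → U ≤ klU0WindowD010D035V4U → lamB U < lamX U :=
  klU0Win_sound _ _ _ _ klU0WindowD010D035V4Rows_check

open Literature.MathematicalPhysics.QuantumLattice in
/-- **The same on the doping window `δ ∈ [0.10, 0.35]`** (certified fillings n(-0.8925) < 13/20, n(-0.1775) ≥ 9/10, `muOfDoping_mem_window_d010_d035`): for every such `δ` a row's box contains
`μ(δ) = chemicalPotentialOfDensity ε₀ (1-δ)` and, modulo that row's named hypotheses, `B1g` stays strictly lowest for `0 < U ≤ klU0WindowD010D035V4U`.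
[cite: ScalapinoLohHirsch1986, (3)-(4)] -/
theorem klU0WindowD010D035V4_sound_doping (δ : ℝ) (hδ : δ ∈ Set.Icc (0.10 : ℝ) 0.35) :
    ∃ r ∈ klU0WindowD010D035V4Rows, ((r.mulo : ℚ) : ℝ) ≤ chemicalPotentialOfDensity (squareDispersion 1 0) (1 - δ) ∧
      chemicalPotentialOfDensity (squareDispersion 1 0) (1 - δ) ≤ ((r.muhi : ℚ) : ℝ) ∧
        ∀ c ∈ r.row.chans, ∀ lamB lamX : ℝ → ℝ,
          (∀ U : ℝ, 0 < U → U ≤ r.row.U1 → lamB U ≤ r.row.rhohi + U * (r.row.c3B + r.row.tB) + U ^ 2 * (r.row.c4B + r.row.C4)) →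
          (∀ U : ℝ, 0 < U → U ≤ r.row.U1 → (c.low : ℝ) - U * (c.s3 + c.t) - U ^ 2 * (c.s4 + r.row.C4) ≤ lamX U) →
          ∀ U : ℝ, 0 < U → U ≤ klU0WindowD010D035V4U → lamB U < lamX U := by
  obtain ⟨h₁, h₂⟩ := muOfDoping_mem_window_d010_d035 δ hδ
  exact klU0WindowD010D035V4_sound _ (by push_cast; linarith) (by push_cast; linarith)

open Literature.MathematicalPhysics.QuantumLattice in
/-- **The same on the doping window `δ ∈ [0.10, 0.30]`** (certified fillings n(-0.7275) < 7/10, n(-0.1775) ≥ 9/10, `muOfDoping_mem_window_d010_d030`): for every such `δ` a row's box contains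
`μ(δ) = chemicalPotentialOfDensity ε₀ (1-δ)` and, modulo that row's named hypotheses, `B1g` stays strictly lowest for `0 < U ≤ klU0WindowD010D035V4U`.
[cite: ScalapinoLohHirsch1986, (3)-(4)] -/
theorem klU0WindowD010D035V4_sound_doping_d030 (δ : ℝ) (hδ : δ ∈ Set.Icc (0.10 : ℝ) 0.30) :
    ∃ r ∈ klU0WindowD010D035V4Rows, ((r.mulo : ℚ) : ℝ) ≤ chemicalPotentialOfDensity (squareDispersion 1 0) (1 - δ) ∧
      chemicalPotentialOfDensity (squareDispersion 1 0) (1 - δ) ≤ ((r.muhi : ℚ) : ℝ) ∧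
        ∀ c ∈ r.row.chans, ∀ lamB lamX : ℝ → ℝ,
          (∀ U : ℝ, 0 < U → U ≤ r.row.U1 → lamB U ≤ r.row.rhohi + U * (r.row.c3B + r.row.tB) + U ^ 2 * (r.row.c4B + r.row.C4)) →
          (∀ U : ℝ, 0 < U → U ≤ r.row.U1 → (c.low : ℝ) - U * (c.s3 + c.t) - U ^ 2 * (c.s4 + r.row.C4) ≤ lamX U) →
          ∀ U : ℝ, 0 < U → U ≤ klU0WindowD010D035V4U → lamB U < lamX U := by
  obtain ⟨h₁, h₂⟩ := muOfDoping_mem_window_d010_d030 δ hδ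
  exact klU0WindowD010D035V4_sound _ (by push_cast; linarith) (by push_cast; linarith)

end Summit.HubbardSuperconductivity.HubbardSuperconductivity.Theorems

end
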